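import Summits.RiemannHypothesis.RiemannHypothesis.Theorems.UniversalFactorNarrowKernelNoGoEnergyUpperKernel
import Summits.RiemannHypothesis.RiemannHypothesis.Theorems.UniversalFactorNarrowKernelNoGoEnergyUpperMajorant
import Literature.Analysis.Fourier.GaussianMeanValue

/-!
# RiemannHypothesis / UniversalFactor — `NarrowKernelNoGo`, stub K1b (energy upper bound), part 3:
freezing the filtered coefficients

Route `RiemannHypothesis/UniversalFactor`, crux `NarrowKernelNoGo` (stmt-RiemannHypothesis-2576), line
`Sketch`, stub `stub_narrowEnergyUpper`. Inserting Hardy's first approximation `Z = 2Re(E₁ S_P) + e_P`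
into the filtered function `w(t) ∫ k(u) E(t+u) Z(t+u) du` produces the Dirichlet polynomial
`∑_{n ≤ P} n^{-1/2} e^{-it log n} γ_n(t)` with coefficients
`γ_n(t) = ∫ k(u) E(t+u) w(t) E₁(t+u) e^{-iu log n} du`. This file proves the **coefficient
approximation** `UniversalFactor.narrowUpper_coeff_approx`:

  `‖γ(t, λ) − E₁(t) c₀ ∫ k(u) e^{-πu/4} e^{iu(½log(t/2π) − λ)} du‖ ≤ C₃ / t`   (`t ≥ max T₀ 1`, all real `λ`),

from the envelope asymptotics `E(t+u) w(t) = c₀ e^{-πu/4} + O(e^{-πu/4}(1+|u|)/t)` (`|u| ≤ t/2`), the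
phase linearisation `φ(t+u) − φ(t) − uφ'(t) = O(u²/t)` and the kernel majorant on `|u| > t/2`; the
constant is `C₃ = B (C + c₀ + 2C₀ + 2c₀) ∫ (2+|u|)³ e^{-(2a−π/4)|u|} du`. Hence
`γ_n(t) = E₁(t) c₀ ĝ(½ log(t/2π) − log n) + O(1/t)` with the EXPLICIT transform `ĝ` of part 1.

References: Titchmarsh, *The Theory of the Riemann Zeta-Function* (1986), §7.3–7.4, §9.20.
-/

noncomputable section

-- D-0017: `Summit.<S>.<S>.…` is the designed namespace of a single-problem summit.
set_option linter.dupNamespace false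

namespace Summit.RiemannHypothesis.RiemannHypothesis.Theorems

open MeasureTheory Set Filter Complex intervalIntegral
open scoped Real Topology
open Literature.NumberTheory.LFunctions

/-- Nonnegativity of the constants `B, C₀, C` of the kernel bound, the envelope majorant and the
envelope asymptotics (each follows from the bound at one point). [folklore] -/
theorem UniversalFactor.narrowUpper_consts_nonneg {E k : ℝ → ℝ} {B a C₀ c₀ C T₀ : ℝ}
    (hk : ∀ u : ℝ, |k u| ≤ B * Real.exp (-(2 * a * |u|))) (hE0 : ∀ τ : ℝ, 0 ≤ E τ)
    (hmaj : ∀ t : ℝ, 1 ≤ t → ∀ u : ℝ, E (t + u) * (t ^ (-(7 : ℝ) / 4) * Real.exp (π * t / 4)) ≤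
      C₀ * (2 + |u|) ^ 2 * Real.exp (-(π * u / 4)))
    (henv : ∀ t : ℝ, T₀ ≤ t → ∀ u : ℝ, |u| ≤ t / 2 →
      |E (t + u) * (t ^ (-(7 : ℝ) / 4) * Real.exp (π * t / 4)) - c₀ * Real.exp (-(π * u / 4))| ≤
        C * Real.exp (-(π * u / 4)) * (1 + |u|) / t) :
    0 ≤ B ∧ 0 ≤ C₀ ∧ 0 ≤ C := by
  refine ⟨?_, ?_, ?_⟩
  · have := (abs_nonneg _).trans (hk 0); simpa using this
  · have h := hmaj 1 le_rfl 0
    have h1 : 0 ≤ E (1 + 0) * ((1:ℝ) ^ (-(7 : ℝ) / 4) * Real.exp (π * 1 / 4)) :=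
      mul_nonneg (hE0 _) (UniversalFactor.narrowUpper_weight_pos one_pos).le
    have h2 : C₀ * (2 + |(0:ℝ)|) ^ 2 * Real.exp (-(π * 0 / 4)) = 4 * C₀ := by simp; ring
    linarith
  · set t := max T₀ 1 with ht
    have ht0 : 0 < t := lt_of_lt_of_le one_pos (le_max_right _ _)
    have h := henv t (le_max_left _ _) 0 (by rw [abs_zero]; positivity)
    have h1 : C * Real.exp (-(π * 0 / 4)) * (1 + |(0:ℝ)|) / t = C / t := by simp
    rw [h1] at h
    have h2 : 0 ≤ C / t := (abs_nonneg _).trans h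
    exact (div_nonneg_iff.1 h2).elim (fun h => h.1) (fun h => absurd h.2 (not_le.2 ht0))

/-- **The frozen-coefficient integrand, pointwise.** For `t ≥ max(T₀, 1)`, real `u, λ`, with
`w = t^{-7/4}e^{πt/4}`, `L = ½ log(t/2π)`:
`‖k(u)E(t+u)w·E₁(t+u)e^{-iuλ} − E₁(t)c₀·k(u)e^{-πu/4}e^{i(L−λ)u}‖ ≤ B(C + c₀ + 2C₀ + 2c₀)(2+|u|)³e^{-(2a−π/4)|u|}/t`
(case `|u| ≤ t/2`: envelope asymptotics and phase linearisation; case `|u| > t/2`: the majorant and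
`1 < 2(2+|u|)/t`). [folklore] -/
theorem UniversalFactor.narrowUpper_coeff_pointwise {E k : ℝ → ℝ} {B a C₀ c₀ C T₀ : ℝ}
    (hk : ∀ u : ℝ, |k u| ≤ B * Real.exp (-(2 * a * |u|))) (hE0 : ∀ τ : ℝ, 0 ≤ E τ)
    (hmaj : ∀ t : ℝ, 1 ≤ t → ∀ u : ℝ, E (t + u) * (t ^ (-(7 : ℝ) / 4) * Real.exp (π * t / 4)) ≤
      C₀ * (2 + |u|) ^ 2 * Real.exp (-(π * u / 4)))
    (henv : ∀ t : ℝ, T₀ ≤ t → ∀ u : ℝ, |u| ≤ t / 2 →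
      |E (t + u) * (t ^ (-(7 : ℝ) / 4) * Real.exp (π * t / 4)) - c₀ * Real.exp (-(π * u / 4))| ≤
        C * Real.exp (-(π * u / 4)) * (1 + |u|) / t)
    (hc₀ : 0 ≤ c₀) {t : ℝ} (ht : max T₀ 1 ≤ t) (u l : ℝ) :
    ‖(((k u * (E (t + u) * (t ^ (-(7 : ℝ) / 4) * Real.exp (π * t / 4)))) : ℝ) : ℂ) *
          (TwistedMoment.thetaMainPhase (t + u) * cexp (-(I * u * l))) -
        TwistedMoment.thetaMainPhase t * (c₀ : ℂ) *
          (((k u * Real.exp (-(π * u / 4)) : ℝ) : ℂ) * cexp (↑((1 / 2 * Real.log (t / (2 * π)) - l) * u) * I))‖ ≤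
      B * (C + c₀ + 2 * C₀ + 2 * c₀) / t * ((2 + |u|) ^ 3 * Real.exp (-((2 * a - π / 4) * |u|))) := by
  have ht1 : 1 ≤ t := (le_max_right _ _).trans ht
  have htT : T₀ ≤ t := (le_max_left _ _).trans ht
  have ht0 : 0 < t := by linarith
  obtain ⟨hB, hC0, hC⟩ := UniversalFactor.narrowUpper_consts_nonneg hk hE0 hmaj henv
  set w := t ^ (-(7 : ℝ) / 4) * Real.exp (π * t / 4) with hw
  set L := 1 / 2 * Real.log (t / (2 * π)) with hL
  set c := 2 * a - π / 4 with hc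
  have hw0 : 0 < w := UniversalFactor.narrowUpper_weight_pos ht0
  have hEw0 : 0 ≤ E (t + u) * w := mul_nonneg (hE0 _) hw0.le
  set P₁ := TwistedMoment.thetaMainPhase (t + u) with hP₁
  set P₂ := TwistedMoment.thetaMainPhase t * cexp (↑(L * u) * I) with hP₂
  have hP₁n : ‖P₁‖ = 1 := TwistedMoment.norm_thetaMainPhase _
  have hP₂n : ‖P₂‖ = 1 := by
    rw [hP₂, norm_mul, TwistedMoment.norm_thetaMainPhase, Complex.norm_exp_ofReal_mul_I, mul_one]
  set Δ : ℂ := ((E (t + u) * w : ℝ) : ℂ) * P₁ - ((c₀ * Real.exp (-(π * u / 4)) : ℝ) : ℂ) * P₂ with hΔ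
  -- factorisation
  have hfac : (((k u * (E (t + u) * w)) : ℝ) : ℂ) * (P₁ * cexp (-(I * u * l))) -
      TwistedMoment.thetaMainPhase t * (c₀ : ℂ) *
        (((k u * Real.exp (-(π * u / 4)) : ℝ) : ℂ) * cexp (↑((L - l) * u) * I)) =
      ((k u : ℝ) : ℂ) * cexp (-(I * u * l)) * Δ := by
    have hsplit : cexp (↑((L - l) * u) * I) = cexp (↑(L * u) * I) * cexp (-(I * u * l)) := by
      rw [← Complex.exp_add]; congr 1; push_cast; ring
    rw [hsplit, hΔ, hP₂]
    push_cast
    ring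
  rw [hfac, norm_mul, norm_mul, Literature.Analysis.Fourier.GaussianMeanValue.norm_cexp_neg_I_mul_mul, mul_one, Complex.norm_real,
    Real.norm_eq_abs]
  have hk' := hk u
  have hprof : Real.exp (-(2 * a * |u|)) * Real.exp (-(π * u / 4)) ≤ Real.exp (-(c * |u|)) := by
    rw [← Real.exp_add]; exact Real.exp_le_exp.2 (UniversalFactor.narrowUpper_exponent_le a u)
  have h2u : (1:ℝ) ≤ 2 + |u| := by linarith [abs_nonneg u]
  rcases le_or_gt |u| (t / 2) with hu | hu
  · -- `|u| ≤ t/2`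
    have hΔle : ‖Δ‖ ≤ (C * (1 + |u|) + c₀ * (u ^ 2 / 2)) * Real.exp (-(π * u / 4)) / t := by
      have hsplit : Δ = ((E (t + u) * w - c₀ * Real.exp (-(π * u / 4)) : ℝ) : ℂ) * P₁ +
          ((c₀ * Real.exp (-(π * u / 4)) : ℝ) : ℂ) * (P₁ - P₂) := by
        rw [hΔ]; push_cast; ring
      have h1 := henv t htT u hu
      have h2 : ‖P₁ - P₂‖ ≤ u ^ 2 / (2 * t) := by
        rw [hP₁, hP₂, hL]; exact UniversalFactor.narrowUpper_norm_thetaMainPhase_sub_le ht0 hu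
      calc ‖Δ‖ ≤ ‖((E (t + u) * w - c₀ * Real.exp (-(π * u / 4)) : ℝ) : ℂ) * P₁‖ +
            ‖((c₀ * Real.exp (-(π * u / 4)) : ℝ) : ℂ) * (P₁ - P₂)‖ := by rw [hsplit]; exact norm_add_le _ _
        _ = |E (t + u) * w - c₀ * Real.exp (-(π * u / 4))| + c₀ * Real.exp (-(π * u / 4)) * ‖P₁ - P₂‖ := by
            rw [norm_mul, norm_mul, hP₁n, mul_one, Complex.norm_real, Complex.norm_real, Real.norm_eq_abs,
              Real.norm_eq_abs, abs_of_nonneg (by positivity : 0 ≤ c₀ * Real.exp (-(π * u / 4)))]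
        _ ≤ C * Real.exp (-(π * u / 4)) * (1 + |u|) / t + c₀ * Real.exp (-(π * u / 4)) * (u ^ 2 / (2 * t)) := by
            gcongr
        _ = (C * (1 + |u|) + c₀ * (u ^ 2 / 2)) * Real.exp (-(π * u / 4)) / t := by
            field_simp
    have hpoly : C * (1 + |u|) + c₀ * (u ^ 2 / 2) ≤ (C + c₀) * (2 + |u|) ^ 2 := by
      have h1 : 1 + |u| ≤ (2 + |u|) ^ 2 := by nlinarith [abs_nonneg u]
      have h2 : u ^ 2 / 2 ≤ (2 + |u|) ^ 2 := by nlinarith [abs_nonneg u, sq_abs u]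
      nlinarith
    calc |k u| * ‖Δ‖ ≤ (B * Real.exp (-(2 * a * |u|))) *
          ((C * (1 + |u|) + c₀ * (u ^ 2 / 2)) * Real.exp (-(π * u / 4)) / t) :=
          mul_le_mul hk' hΔle (norm_nonneg _) (by positivity)
      _ = B * (C * (1 + |u|) + c₀ * (u ^ 2 / 2)) / t *
            (Real.exp (-(2 * a * |u|)) * Real.exp (-(π * u / 4))) := by ring
      _ ≤ B * ((C + c₀) * (2 + |u|) ^ 2) / t * Real.exp (-(c * |u|)) := by gcongr
      _ ≤ B * (C + c₀ + 2 * C₀ + 2 * c₀) / t * ((2 + |u|) ^ 3 * Real.exp (-(c * |u|))) := by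
          have h3 : (2 + |u|) ^ 2 ≤ (2 + |u|) ^ 3 := pow_le_pow_right₀ h2u (by norm_num)
          have h4 : (C + c₀) * (2 + |u|) ^ 2 ≤ (C + c₀ + 2 * C₀ + 2 * c₀) * (2 + |u|) ^ 3 := by
            nlinarith [mul_nonneg (by positivity : 0 ≤ 2 * C₀ + 2 * c₀) (by positivity : (0:ℝ) ≤ (2 + |u|) ^ 3),
              mul_le_mul_of_nonneg_left h3 (by positivity : 0 ≤ C + c₀)]
          have h5 : 0 ≤ Real.exp (-(c * |u|)) := (Real.exp_pos _).le
          calc B * ((C + c₀) * (2 + |u|) ^ 2) / t * Real.exp (-(c * |u|))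
              = B / t * ((C + c₀) * (2 + |u|) ^ 2) * Real.exp (-(c * |u|)) := by ring
            _ ≤ B / t * ((C + c₀ + 2 * C₀ + 2 * c₀) * (2 + |u|) ^ 3) * Real.exp (-(c * |u|)) := by gcongr
            _ = _ := by ring
  · -- `|u| > t/2`
    have hΔle : ‖Δ‖ ≤ E (t + u) * w + c₀ * Real.exp (-(π * u / 4)) := by
      calc ‖Δ‖ ≤ ‖((E (t + u) * w : ℝ) : ℂ) * P₁‖ + ‖((c₀ * Real.exp (-(π * u / 4)) : ℝ) : ℂ) * P₂‖ :=
            norm_sub_le _ _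
        _ = E (t + u) * w + c₀ * Real.exp (-(π * u / 4)) := by
            rw [norm_mul, norm_mul, hP₁n, hP₂n, mul_one, mul_one, Complex.norm_real, Complex.norm_real,
              Real.norm_eq_abs, Real.norm_eq_abs, abs_of_nonneg hEw0,
              abs_of_nonneg (by positivity : 0 ≤ c₀ * Real.exp (-(π * u / 4)))]
    have hK := UniversalFactor.narrowUpper_kernel_majorant hmaj hE0 hk ht1 u
    have h1 : |k u| * ‖Δ‖ ≤ B * (C₀ + c₀) * ((2 + |u|) ^ 2 * Real.exp (-(c * |u|))) := by
      calc |k u| * ‖Δ‖ ≤ |k u| * (E (t + u) * w + c₀ * Real.exp (-(π * u / 4))) :=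
            mul_le_mul_of_nonneg_left hΔle (abs_nonneg _)
        _ = |k u| * (E (t + u) * w) + |k u| * Real.exp (-(π * u / 4)) * c₀ := by ring
        _ ≤ B * C₀ * ((2 + |u|) ^ 2 * Real.exp (-(c * |u|))) +
              (B * Real.exp (-(2 * a * |u|))) * Real.exp (-(π * u / 4)) * c₀ := by gcongr
        _ = B * C₀ * ((2 + |u|) ^ 2 * Real.exp (-(c * |u|))) +
              B * c₀ * (Real.exp (-(2 * a * |u|)) * Real.exp (-(π * u / 4))) := by ring
        _ ≤ B * C₀ * ((2 + |u|) ^ 2 * Real.exp (-(c * |u|))) + B * c₀ * ((2 + |u|) ^ 2 * Real.exp (-(c * |u|))) := by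
            gcongr B * C₀ * ((2 + |u|) ^ 2 * Real.exp (-(c * |u|))) + B * c₀ * ?_
            calc Real.exp (-(2 * a * |u|)) * Real.exp (-(π * u / 4)) ≤ Real.exp (-(c * |u|)) := hprof
              _ = 1 * Real.exp (-(c * |u|)) := (one_mul _).symm
              _ ≤ (2 + |u|) ^ 2 * Real.exp (-(c * |u|)) := by gcongr; nlinarith
        _ = B * (C₀ + c₀) * ((2 + |u|) ^ 2 * Real.exp (-(c * |u|))) := by ring
    have h2 : (1:ℝ) ≤ 2 * (2 + |u|) / t := by
      rw [le_div_iff₀ ht0]; linarith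
    calc |k u| * ‖Δ‖ ≤ B * (C₀ + c₀) * ((2 + |u|) ^ 2 * Real.exp (-(c * |u|))) * 1 := by rw [mul_one]; exact h1
      _ ≤ B * (C₀ + c₀) * ((2 + |u|) ^ 2 * Real.exp (-(c * |u|))) * (2 * (2 + |u|) / t) := by gcongr
      _ = B * (2 * C₀ + 2 * c₀) / t * ((2 + |u|) ^ 3 * Real.exp (-(c * |u|))) := by ring
      _ ≤ B * (C + c₀ + 2 * C₀ + 2 * c₀) / t * ((2 + |u|) ^ 3 * Real.exp (-(c * |u|))) := by
          gcongr; linarith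

/-- The coefficient integrand `u ↦ k(u)E(t+u)w(t) · E₁(t+u) e^{-iuλ}` is integrable (`t ≥ 1`): it is
measurable and dominated by the kernel majorant `B C₀ (2+|u|)² e^{-(2a−π/4)|u|}`. [folklore] -/
theorem UniversalFactor.narrowUpper_integrable_coeff {E k : ℝ → ℝ} {B a C₀ : ℝ} (ha : π / 8 < a)
    (hkm : Measurable k) (hk : ∀ u : ℝ, |k u| ≤ B * Real.exp (-(2 * a * |u|)))
    (hEc : Continuous E) (hE0 : ∀ τ : ℝ, 0 ≤ E τ)
    (hmaj : ∀ t : ℝ, 1 ≤ t → ∀ u : ℝ, E (t + u) * (t ^ (-(7 : ℝ) / 4) * Real.exp (π * t / 4)) ≤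
      C₀ * (2 + |u|) ^ 2 * Real.exp (-(π * u / 4)))
    {t : ℝ} (ht1 : 1 ≤ t) (l : ℝ) :
    Integrable fun u : ℝ => (((k u * (E (t + u) * (t ^ (-(7 : ℝ) / 4) * Real.exp (π * t / 4)))) : ℝ) : ℂ) *
      (TwistedMoment.thetaMainPhase (t + u) * cexp (-(I * u * l))) := by
  have ht0 : 0 < t := by linarith
  have hc : 0 < 2 * a - π / 4 := by linarith
  set w := t ^ (-(7 : ℝ) / 4) * Real.exp (π * t / 4) with hw
  have hw0 : 0 < w := UniversalFactor.narrowUpper_weight_pos ht0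
  have hEw_meas : Measurable fun u : ℝ => k u * (E (t + u) * w) :=
    hkm.mul (((hEc.comp ((continuous_const.add continuous_id))).mul continuous_const).measurable)
  have hθc : Continuous fun u : ℝ => TwistedMoment.thetaMainPhase (t + u) :=
    UniversalFactor.narrowUpper_continuous_thetaMainPhase.comp ((continuous_const.add continuous_id))
  have hf_meas : AEStronglyMeasurable (fun u : ℝ => (((k u * (E (t + u) * w)) : ℝ) : ℂ) *
      (TwistedMoment.thetaMainPhase (t + u) * cexp (-(I * u * l)))) volume := by
    refine ((Complex.measurable_ofReal.comp hEw_meas).aestronglyMeasurable).mul ?_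
    exact (hθc.mul (by fun_prop)).aestronglyMeasurable
  refine UniversalFactor.narrowUpper_integrable_of_le hf_meas hc (B * C₀) 2 fun u => ?_
  simp only [norm_mul, Complex.norm_real, Real.norm_eq_abs, TwistedMoment.norm_thetaMainPhase,
    Literature.Analysis.Fourier.GaussianMeanValue.norm_cexp_neg_I_mul_mul, mul_one]
  have hK := UniversalFactor.narrowUpper_kernel_majorant hmaj hE0 hk ht1 u
  rw [← hw] at hK
  simpa only [abs_of_pos hw0, abs_of_nonneg (hE0 _), abs_mul] using hK

/-- **Freezing the filtered coefficients.** Under the kernel bound `|k| ≤ B e^{-2a|u|}` (`k` measurable),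
the envelope majorant and the envelope asymptotics, for `t ≥ max(T₀, 1)` and every real `λ`:
`‖∫ k(u)E(t+u)w(t) E₁(t+u) e^{-iuλ} du − E₁(t) c₀ ∫ k(u) e^{-πu/4} e^{i(½log(t/2π) − λ)u} du‖ ≤ C₃/t`,
`C₃ = B(C + c₀ + 2C₀ + 2c₀) ∫ (2+|u|)³ e^{-(2a−π/4)|u|} du`. [folklore] -/
theorem UniversalFactor.narrowUpper_coeff_approx_of {E k : ℝ → ℝ} {B a C₀ c₀ C T₀ : ℝ} (ha : π / 8 < a)
    (hkm : Measurable k) (hk : ∀ u : ℝ, |k u| ≤ B * Real.exp (-(2 * a * |u|)))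
    (hEc : Continuous E) (hE0 : ∀ τ : ℝ, 0 ≤ E τ)
    (hmaj : ∀ t : ℝ, 1 ≤ t → ∀ u : ℝ, E (t + u) * (t ^ (-(7 : ℝ) / 4) * Real.exp (π * t / 4)) ≤
      C₀ * (2 + |u|) ^ 2 * Real.exp (-(π * u / 4)))
    (henv : ∀ t : ℝ, T₀ ≤ t → ∀ u : ℝ, |u| ≤ t / 2 →
      |E (t + u) * (t ^ (-(7 : ℝ) / 4) * Real.exp (π * t / 4)) - c₀ * Real.exp (-(π * u / 4))| ≤
        C * Real.exp (-(π * u / 4)) * (1 + |u|) / t)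
    (hc₀ : 0 ≤ c₀) {t : ℝ} (ht : max T₀ 1 ≤ t) (l : ℝ) :
    ‖(∫ u : ℝ, (((k u * (E (t + u) * (t ^ (-(7 : ℝ) / 4) * Real.exp (π * t / 4)))) : ℝ) : ℂ) *
          (TwistedMoment.thetaMainPhase (t + u) * cexp (-(I * u * l)))) -
        TwistedMoment.thetaMainPhase t * (c₀ : ℂ) *
          ∫ u : ℝ, ((k u * Real.exp (-(π * u / 4)) : ℝ) : ℂ) *
            cexp (↑((1 / 2 * Real.log (t / (2 * π)) - l) * u) * I)‖ ≤
      B * (C + c₀ + 2 * C₀ + 2 * c₀) * (∫ u : ℝ, (2 + |u|) ^ 3 * Real.exp (-((2 * a - π / 4) * |u|))) / t := by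
  have ht1 : 1 ≤ t := (le_max_right _ _).trans ht
  have ht0 : 0 < t := by linarith
  have hc : 0 < 2 * a - π / 4 := by linarith
  obtain ⟨hB, hC0, hC⟩ := UniversalFactor.narrowUpper_consts_nonneg hk hE0 hmaj henv
  set w := t ^ (-(7 : ℝ) / 4) * Real.exp (π * t / 4) with hw
  set L := 1 / 2 * Real.log (t / (2 * π)) with hL
  have hw0 : 0 < w := UniversalFactor.narrowUpper_weight_pos ht0
  set f : ℝ → ℂ := fun u => (((k u * (E (t + u) * w)) : ℝ) : ℂ) *
    (TwistedMoment.thetaMainPhase (t + u) * cexp (-(I * u * l))) with hf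
  set g : ℝ → ℂ := fun u => TwistedMoment.thetaMainPhase t * (c₀ : ℂ) *
    (((k u * Real.exp (-(π * u / 4)) : ℝ) : ℂ) * cexp (↑((L - l) * u) * I)) with hg
  -- integrability of `f`
  have hf_int : Integrable f := UniversalFactor.narrowUpper_integrable_coeff ha hkm hk hEc hE0 hmaj ht1 l
  -- integrability of `g`
  have hg_meas : AEStronglyMeasurable g volume := by
    refine (aestronglyMeasurable_const.mul ?_)
    refine ((Complex.measurable_ofReal.comp (hkm.mul (by fun_prop))).aestronglyMeasurable).mul ?_
    exact (Continuous.aestronglyMeasurable (by fun_prop))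
  have hg_le : ∀ u, ‖g u‖ ≤ c₀ * B * ((2 + |u|) ^ 0 * Real.exp (-((2 * a - π / 4) * |u|))) := by
    intro u
    simp only [hg, norm_mul, Complex.norm_real, Real.norm_eq_abs, TwistedMoment.norm_thetaMainPhase,
      Complex.norm_exp_ofReal_mul_I, mul_one, one_mul, pow_zero, abs_of_nonneg hc₀]
    rw [abs_of_pos (Real.exp_pos _)]
    calc c₀ * (|k u| * Real.exp (-(π * u / 4))) ≤ c₀ * ((B * Real.exp (-(2 * a * |u|))) * Real.exp (-(π * u / 4))) := by
          gcongr; exact hk u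
      _ = c₀ * B * (Real.exp (-(2 * a * |u|)) * Real.exp (-(π * u / 4))) := by ring
      _ ≤ c₀ * B * Real.exp (-((2 * a - π / 4) * |u|)) := by
          gcongr; rw [← Real.exp_add]; exact Real.exp_le_exp.2 (UniversalFactor.narrowUpper_exponent_le a u)
  have hg_int : Integrable g := UniversalFactor.narrowUpper_integrable_of_le hg_meas hc _ 0 hg_le
  -- the difference
  have hsub : (∫ u : ℝ, f u) - TwistedMoment.thetaMainPhase t * (c₀ : ℂ) *
      ∫ u : ℝ, ((k u * Real.exp (-(π * u / 4)) : ℝ) : ℂ) * cexp (↑((L - l) * u) * I) =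
      ∫ u : ℝ, (f u - g u) := by
    rw [← MeasureTheory.integral_const_mul, ← integral_sub hf_int hg_int]
  have hbound_int : Integrable fun u : ℝ =>
      B * (C + c₀ + 2 * C₀ + 2 * c₀) / t * ((2 + |u|) ^ 3 * Real.exp (-((2 * a - π / 4) * |u|))) :=
    (UniversalFactor.narrowUpper_integrable_pow_mul_exp hc 3).const_mul _
  calc ‖(∫ u : ℝ, f u) - TwistedMoment.thetaMainPhase t * (c₀ : ℂ) *
        ∫ u : ℝ, ((k u * Real.exp (-(π * u / 4)) : ℝ) : ℂ) * cexp (↑((L - l) * u) * I)‖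
      = ‖∫ u : ℝ, (f u - g u)‖ := by rw [hsub]
    _ ≤ ∫ u : ℝ, ‖f u - g u‖ := norm_integral_le_integral_norm _
    _ ≤ ∫ u : ℝ, B * (C + c₀ + 2 * C₀ + 2 * c₀) / t * ((2 + |u|) ^ 3 * Real.exp (-((2 * a - π / 4) * |u|))) := by
        refine integral_mono (hf_int.sub hg_int).norm hbound_int fun u => ?_
        exact UniversalFactor.narrowUpper_coeff_pointwise hk hE0 hmaj henv hc₀ ht u l
    _ = B * (C + c₀ + 2 * C₀ + 2 * c₀) * (∫ u : ℝ, (2 + |u|) ^ 3 * Real.exp (-((2 * a - π / 4) * |u|))) / t := by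
        rw [MeasureTheory.integral_const_mul]; ring

/-- **Registered sub-stub `narrowUpper_coeff_approx`** (verbatim signature): the coefficient approximation `γ(t,λ) = E₁(t) c₀ ĝ(½log(t/2π) − λ) + O(1/t)`. [folklore] -/
theorem UniversalFactor.narrowUpper_coeff_approx : ∀ {E k : ℝ → ℝ} {B a C₀ c₀ C T₀ : ℝ}, Real.pi / 8 < a → Measurable k → (∀ u : ℝ, |k u| ≤ B * Real.exp (-(2 * a * |u|))) → Continuous E → (∀ τ : ℝ, 0 ≤ E τ) → (∀ t : ℝ, 1 ≤ t → ∀ u : ℝ, E (t + u) * (t ^ (-(7 : ℝ) / 4) * Real.exp (Real.pi * t / 4)) ≤ C₀ * (2 + |u|) ^ 2 * Real.exp (-(Real.pi * u / 4))) → (∀ t : ℝ, T₀ ≤ t → ∀ u : ℝ, |u| ≤ t / 2 → |E (t + u) * (t ^ (-(7 : ℝ) / 4) * Real.exp (Real.pi * t / 4)) - c₀ * Real.exp (-(Real.pi * u / 4))| ≤ C * Real.exp (-(Real.pi * u / 4)) * (1 + |u|) / t) → 0 ≤ c₀ → ∀ {t : ℝ}, max T₀ 1 ≤ t → ∀ l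 : ℝ, ‖(∫ u : ℝ, (((k u * (E (t + u) * (t ^ (-(7 : ℝ) / 4) * Real.exp (Real.pi * t / 4)))) : ℝ) : ℂ) * (Literature.NumberTheory.LFunctions.TwistedMoment.thetaMainPhase (t + u) * Complex.exp (-(Complex.I * u * l)))) - Literature.NumberTheory.LFunctions.TwistedMoment.thetaMainPhase t * (c₀ : ℂ) * ∫ u : ℝ, ((k u * Real.exp (-(Real.pi * u / 4)) : ℝ) : ℂ) * Complex.exp (↑((1 / 2 * Real.log (t / (2 * Real.pi)) - l) * u) * Complex.I)‖ ≤ B * (C + c₀ + 2 * C₀ + 2 * c₀) * (∫ u : ℝ, (2 + |u|) ^ 3 * Real.exp (-((2 * a - Real.pi / 4) * |u|))) / t :=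
  fun ha hkm hk hEc hE0 hmaj henv hc₀ _ ht l => UniversalFactor.narrowUpper_coeff_approx_of ha hkm hk hEc hE0 hmaj henv hc₀ ht l

end Summit.RiemannHypothesis.RiemannHypothesis.Theorems
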